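import Mathlib
import Summits.ResolutionOfSingularities.ResolutionOfSingularities.Theorems.RadicialJungCleanModelsCleanPermissibleCriteria
import Summits.ResolutionOfSingularities.ResolutionOfSingularities.Theorems.RadicialJungCleanModelsContactChainGenericType
import HarnessLib

/-!
# Route `RadicialJung`, crux `CleanModels` (stmt-ResolutionOfSingularities-15917), line `Sketch` rev 35, stub 6 `stub_cleanProp44` (X44c),
# work plan O8 / L7b-global, item (G1) for the clean type (1) with two factors: SPREADING clean-permissibility from the generic point of the
# curve to all points off one divisor

Memo `Cruxes/CleanModels/Lines/Sketch-memo-hand2-g9-stubs-5-7.md` §3a (G1-types 1/3).  RING LEVEL: `A` a domain (an affine coordinate ring of the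
stage), `𝔭` a prime (the curve), `B = A_𝔭` its local ring with `K = Frac A`, `q₀, q₁ ∈ A` generating `𝔭B` (the uniform regular pair of
✓ `exists_affineOpen_forall_isRsopPart_germ`).  If the line of `G` has at `B` a clean representative of type (1) with TWO factors,
`u · t₀^{a₀} t₁^{a₁}` (`(t₀, t₁)` generating `𝔪_B`, `u ∈ B^×`, `p ∤ a_j`), then there is ONE element `g ∉ 𝔭` such that at EVERY prime `𝔮 ⊇ 𝔭`
with `g ∉ 𝔮` at which `A_𝔮` is regular and `(q₀, q₁)` is part of a regular system of parameters generating `𝔭A_𝔮`, the line is CLEAN-PERMISSIBLE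
for `𝔭A_𝔮` (`exists_not_mem_forall_cleanPermissibleAt_of_generic_pair`).  Proof: clear denominators (`Q_i = s_i^{p−1} a_i`, `v = s^{p−1} v₀`) and
collect in `g` the denominators, the numerator of the unit and the multipliers `e_j` with `e_j q_j ∈ (Q₀, Q₁)`; at such `𝔮` the `Q_i` generate `𝔭A_𝔮`,
`v` is a unit, and ✓ `cleanPermissibleAt_of_split` applies with no transversal factor.  So, for type (1) with two factors, the bad points of the curve
lie on the divisor `V(g)` — finitely many closed points of the curve.

Honest framing: OURS (bookkeeping); the scheme reading (stalks as localizations of `Γ(X, V)`) and types (1)-one-factor / (3) are left to the successor;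
nothing here proves X44c or any case of `CleanModels`.
-/

noncomputable section

set_option linter.dupNamespace false -- mandated namespace of this single-conjunct summit

open IsLocalRing Literature.AlgebraicGeometry.Resolution

namespace Summit.ResolutionOfSingularities.ResolutionOfSingularities.Theorems.RadicialJung.CleanModels

/-- **Generic spreading of a two-factor clean form along the curve (ring level).**  See the module docstring.
[cite: CossartPiltant2008, Prop. 4.4 (proof, p. 10)] [cite: Piltant2013, §2 Axiom 4] [cite: Matsumura1987, Thm. 14.2] -/
theorem exists_not_mem_forall_cleanPermissibleAt_of_generic_pair {A K : Type} [CommRing A] [IsDomain A] [Field K] [Algebra A K]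
    [IsFractionRing A K] (p : ℕ) [hp : Fact p.Prime] (𝔭 : Ideal A) [h𝔭 : 𝔭.IsPrime]
    (B : Type) [CommRing B] [IsLocalRing B] [Algebra A B] [IsLocalization.AtPrime B 𝔭] [Algebra B K] [IsScalarTower A B K]
    (q : Fin 2 → A) (hq : Ideal.map (algebraMap A B) (Ideal.span (Set.range q)) = maximalIdeal B)
    (G : K) (cc : Fin p → K) (hcc : ∃ j : Fin p, (j : ℕ) ≠ 0 ∧ cc j ≠ 0)
    (t : Fin 2 → B) (ht : Ideal.span (Set.range t) = maximalIdeal B) (a : Fin 2 → ℕ) (ha : ∀ i, ¬ p ∣ a i) (u : B) (hu : IsUnit u)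
    (hX : (∑ j : Fin p, cc j ^ p * G ^ (j : ℕ)) = algebraMap B K (u * ∏ i, t i ^ a i)) :
    ∃ g : A, g ∉ 𝔭 ∧ ∀ (𝔮 : Ideal A) [𝔮.IsPrime], g ∉ 𝔮 →
      ∀ (R : Type) [CommRing R] [IsRegularLocalRing R] [Algebra A R] [IsLocalization.AtPrime R 𝔮] [Algebra R K] [IsScalarTower A R K],
        IsRsopPart (fun j => algebraMap A R (q j)) → Ideal.span (Set.range fun j => algebraMap A R (q j)) = Ideal.map (algebraMap A R) 𝔭 →
        ∃ cc' : Fin p → K, (∃ j : Fin p, (j : ℕ) ≠ 0 ∧ cc' j ≠ 0) ∧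
          CleanPermissibleAt p (algebraMap R K) G (Ideal.map (algebraMap A R) 𝔭) := by
  classical
  have hmemP : ∀ x : A, algebraMap A B x ∈ maximalIdeal B ↔ x ∈ 𝔭 := fun x => IsLocalization.AtPrime.to_map_mem_maximal_iff B 𝔭 x
  have hunitP : ∀ x : A, IsUnit (algebraMap A B x) ↔ x ∉ 𝔭 := fun x => IsLocalization.AtPrime.isUnit_to_map_iff B 𝔭 x
  have hsurj : ∀ z : B, ∃ (x d : A), d ∉ 𝔭 ∧ z * algebraMap A B d = algebraMap A B x := fun z => by
    obtain ⟨⟨x, d⟩, h⟩ := IsLocalization.surj 𝔭.primeCompl z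
    exact ⟨x, d, d.2, h⟩
  have hclear : ∀ (z : B) (x d : A), z * algebraMap A B d = algebraMap A B x →
      algebraMap A B d ^ p * z = algebraMap A B (d ^ (p - 1) * x) := by
    intro z x d h
    have hp1 : p = (p - 1) + 1 := (Nat.sub_add_cancel hp.out.one_le).symm
    rw [map_mul, map_pow, ← h]
    conv_lhs => rw [hp1, pow_succ]
    ring
  have hinjK : Function.Injective (algebraMap A K) := IsFractionRing.injective A K
  -- numerators / denominators
  have hts : ∀ i : Fin 2, ∃ x s : A, s ∉ 𝔭 ∧ t i * algebraMap A B s = algebraMap A B x := fun i => hsurj _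
  choose x s hs hxs using hts
  obtain ⟨v₀, s₀, hs₀, hus₀⟩ := hsurj u
  have hv₀ : v₀ ∉ 𝔭 := by
    intro h
    have h1 : algebraMap A B v₀ ∈ maximalIdeal B := (hmemP v₀).mpr h
    rw [← hus₀] at h1
    exact (maximalIdeal.isMaximal B).ne_top (Ideal.eq_top_of_isUnit_mem _ h1 (hu.mul ((hunitP s₀).mpr hs₀)))
  set Q : Fin 2 → A := fun i => s i ^ (p - 1) * x i with hQdef
  set v : A := s₀ ^ (p - 1) * v₀ with hvdef
  have hQφ : ∀ i, algebraMap A B (Q i) = algebraMap A B (s i) ^ p * t i := fun i => (hclear _ _ _ (hxs i)).symm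
  have hvφ : algebraMap A B v = algebraMap A B s₀ ^ p * u := (hclear _ _ _ hus₀).symm
  have hQ𝔭 : ∀ i, Q i ∈ 𝔭 := by
    intro i
    rw [← hmemP, hQφ i]
    refine Ideal.mul_mem_left _ _ ?_
    rw [← ht]; exact Ideal.subset_span ⟨i, rfl⟩
  -- `q_j ∈ (Q₀, Q₁)` after a multiplier off `𝔭`
  have hspanQ : maximalIdeal B ≤ Ideal.map (algebraMap A B) (Ideal.span (Set.range Q)) := by
    rw [← ht, Ideal.span_le]
    rintro _ ⟨i, rfl⟩
    obtain ⟨sU, hsU⟩ := (hunitP (s i)).mpr (hs i)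
    have h2 : t i = (↑sU⁻¹ : B) ^ p * algebraMap A B (Q i) := by
      rw [hQφ i, ← mul_assoc, ← mul_pow, ← hsU, Units.inv_mul, one_pow, one_mul]
    rw [h2]
    exact Ideal.mul_mem_left _ _ (Ideal.mem_map_of_mem _ (Ideal.subset_span ⟨i, rfl⟩))
  have hec : ∀ j : Fin 2, ∃ e : A, e ∉ 𝔭 ∧ e * q j ∈ Ideal.span (Set.range Q) := by
    intro j
    have h1 : algebraMap A B (q j) ∈ Ideal.map (algebraMap A B) (Ideal.span (Set.range Q)) :=
      hspanQ (by rw [← hq]; exact Ideal.mem_map_of_mem _ (Ideal.subset_span ⟨j, rfl⟩))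
    obtain ⟨⟨⟨y, hy⟩, e⟩, hye⟩ := (IsLocalization.mem_map_algebraMap_iff 𝔭.primeCompl B).mp h1
    have h2 : algebraMap A B (q j * e) = algebraMap A B y := by rw [map_mul]; exact hye
    obtain ⟨c, hc⟩ := (IsLocalization.eq_iff_exists 𝔭.primeCompl B).mp h2
    refine ⟨c * e, fun h => (h𝔭.mem_or_mem h).elim c.2 e.2, ?_⟩
    have h4 : (c : A) * e * q j = c * (q j * e) := by ring
    rw [h4, hc]
    exact Ideal.mul_mem_left _ _ hy
  choose e he heQ using hec
  -- the generic divisor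
  set D : A := s₀ * ∏ i, s i ^ a i with hDdef
  have hD𝔭 : D ∉ 𝔭 := by
    intro h
    rcases h𝔭.mem_or_mem h with h1 | h1
    · exact hs₀ h1
    · obtain ⟨i, -, hi⟩ := Ideal.IsPrime.prod_mem_iff.mp h1
      exact hs i (h𝔭.mem_of_pow_mem _ hi)
  refine ⟨e 0 * e 1 * (s₀ * v₀) * D, ?_, ?_⟩
  · intro h
    rcases h𝔭.mem_or_mem h with h1 | h1
    · rcases h𝔭.mem_or_mem h1 with h2 | h2
      · exact (h𝔭.mem_or_mem h2).elim (he 0) (he 1)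
      · exact (h𝔭.mem_or_mem h2).elim hs₀ hv₀
    · exact hD𝔭 h1
  intro 𝔮 _ hg R _ _ _ _ _ _ hqrsop hqspan
  -- what avoids `𝔮`
  have he0 : e 0 ∉ 𝔮 := fun h => hg (by
    have : e 0 * e 1 * (s₀ * v₀) * D = e 0 * (e 1 * (s₀ * v₀) * D) := by ring
    rw [this]; exact Ideal.mul_mem_right _ _ h)
  have he1 : e 1 ∉ 𝔮 := fun h => hg (by
    have : e 0 * e 1 * (s₀ * v₀) * D = e 1 * (e 0 * (s₀ * v₀) * D) := by ring
    rw [this]; exact Ideal.mul_mem_right _ _ h)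
  have hs₀𝔮 : s₀ ∉ 𝔮 := fun h => hg (by
    have : e 0 * e 1 * (s₀ * v₀) * D = s₀ * (e 0 * e 1 * v₀ * D) := by ring
    rw [this]; exact Ideal.mul_mem_right _ _ h)
  have hv₀𝔮 : v₀ ∉ 𝔮 := fun h => hg (by
    have : e 0 * e 1 * (s₀ * v₀) * D = v₀ * (e 0 * e 1 * s₀ * D) := by ring
    rw [this]; exact Ideal.mul_mem_right _ _ h)
  have hD𝔮 : D ∉ 𝔮 := fun h => hg (Ideal.mul_mem_left _ _ h)
  set ψ := algebraMap A R with hψ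
  have hunitQ : ∀ y : A, y ∉ 𝔮 → IsUnit (ψ y) := fun y hy => (IsLocalization.AtPrime.isUnit_to_map_iff R 𝔮 y).mpr hy
  -- the `Q_i` generate `𝔭 A_𝔮`
  have hQJ : ∀ i, ψ (Q i) ∈ Ideal.map ψ 𝔭 := fun i => Ideal.mem_map_of_mem _ (hQ𝔭 i)
  have hspanQR : Ideal.span (Set.range fun i => ψ (Q i)) = Ideal.map ψ 𝔭 := by
    apply le_antisymm
    · rw [Ideal.span_le]; rintro _ ⟨i, rfl⟩; exact hQJ i
    · rw [← hqspan, Ideal.span_le]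
      rintro _ ⟨j, rfl⟩
      obtain ⟨eU, heU⟩ := hunitQ (e j) (by fin_cases j <;> assumption)
      have h1 : ψ (e j * q j) ∈ Ideal.span (Set.range fun i => ψ (Q i)) := by
        have : Ideal.span (Set.range fun i => ψ (Q i)) = Ideal.map ψ (Ideal.span (Set.range Q)) := by
          rw [Ideal.map_span]; congr 1; ext z; simp [Set.mem_range]
        rw [this]; exact Ideal.mem_map_of_mem _ (heQ j)
      rw [map_mul] at h1
      exact (Ideal.unit_mul_mem_iff_mem _ (hunitQ (e j) (by fin_cases j <;> assumption))).mp h1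
  have hQrsop : IsRsopPart (fun i => ψ (Q i)) := isRsopPart_of_span_eq_span hqrsop hqspan hspanQR
  haveI : IsRegularLocalRing (R ⧸ Ideal.map ψ 𝔭) := by rw [← hspanQR]; exact hQrsop.isRegularLocalRing_quotient
  -- the representative, rescaled by `D^p`
  have hRφ : algebraMap A B (v * ∏ i, Q i ^ a i) = algebraMap A B D ^ p * (u * ∏ i, t i ^ a i) := by
    rw [map_mul, hvφ, map_prod]
    have h1 : (∏ i, algebraMap A B (Q i ^ a i)) = (∏ i, algebraMap A B (s i) ^ a i) ^ p * ∏ i, t i ^ a i := by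
      rw [← Finset.prod_pow, ← Finset.prod_mul_distrib]
      refine Finset.prod_congr rfl fun i _ => ?_
      rw [map_pow, hQφ i, mul_pow, ← pow_mul, ← pow_mul, mul_comm p (a i)]
    rw [h1, hDdef, map_mul, map_prod]
    simp only [map_pow]
    ring
  have hDK : algebraMap A K D ≠ 0 := fun h0 => hD𝔭 (by rw [(injective_iff_map_eq_zero _).mp hinjK D h0]; exact 𝔭.zero_mem)
  obtain ⟨hcc', hX'⟩ := rep_scale_mul_pow p G cc hcc (algebraMap A K D) _ hDK hX
  have hXR : (∑ j : Fin p, (fun j => cc j * algebraMap A K D) j ^ p * G ^ (j : ℕ)) =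
      algebraMap R K (ψ v * ∏ i, ψ (Q i) ^ a i) := by
    rw [hX']
    have h1 : algebraMap A K D ^ p * algebraMap B K (u * ∏ i, t i ^ a i) = algebraMap A K (v * ∏ i, Q i ^ a i) := by
      rw [IsScalarTower.algebraMap_apply A B K D, ← map_pow, ← map_mul, ← hRφ, ← IsScalarTower.algebraMap_apply]
    rw [h1, IsScalarTower.algebraMap_apply A R K]
    simp [map_mul, map_pow, hψ]
  have hXR' : (∑ j : Fin p, (fun j => cc j * algebraMap A K D) j ^ p * G ^ (j : ℕ)) =
      algebraMap R K (ψ v * (∏ i, ψ (Q i) ^ a i) * ∏ k : Fin 0, (Fin.elim0 k : R) ^ (Fin.elim0 k : ℕ)) := by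
    rw [Fin.prod_univ_zero, mul_one]; exact hXR
  refine ⟨_, hcc', ?_⟩
  refine cleanPermissibleAt_of_split p (algebraMap R K) G (Ideal.map ψ 𝔭) _ hcc' (fun i => ψ (Q i)) Fin.elim0 hQrsop hQJ
    (fun k => Fin.elim0 k) ?_ a Fin.elim0 (Or.inl ⟨0, ha 0⟩) (ψ v) ?_ hXR'
  · -- the empty family is part of a regular system of parameters of the regular local ring `R/𝔭R`
    haveI : IsLocalRing (R ⧸ Ideal.map ψ 𝔭) := inferInstance
    refine ⟨inferInstance, (maximalIdeal (R ⧸ Ideal.map ψ 𝔭)).spanFinrank,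
      Classical.choose (exists_regularSystemOfParameters (R := R ⧸ Ideal.map ψ 𝔭)), ?_, ?_⟩
    · rw [zero_add]; exact (IsRegularLocalRing.spanFinrank_maximalIdeal (R := R ⧸ Ideal.map ψ 𝔭)).symm
    · rw [Set.range_eq_empty, Set.empty_union]
      exact Classical.choose_spec (exists_regularSystemOfParameters (R := R ⧸ Ideal.map ψ 𝔭))
  · rw [hvdef, map_mul, map_pow]
    exact ((hunitQ s₀ hs₀𝔮).pow _).mul (hunitQ v₀ hv₀𝔮)

end Summit.ResolutionOfSingularities.ResolutionOfSingularities.Theorems.RadicialJung.CleanModels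

end
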